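import Literature.AlgebraicGeometry.Frobenioids.IsometricPreSteps
import Mathlib.CategoryTheory.ObjectProperty.FullSubcategory
import HarnessLib

/-!
# Frobenioids I, Proposition 1.9 (v), part 1: the full subcategory `C^istr` of isotropic objects

Mochizuki, *The geometry of Frobenioids I: the general theory*, Kyushu J. Math. **62** (2008)
293–400, §1, Proposition 1.9 (v), kurims text pp. 32–33 [cite: MochizukiFrdI2008, Prop. 1.9(v)]:
"`C^istr` [equipped with the restriction to `C^istr` of the given functor `C → F_Φ`] is a Frobenioid
… all of these properties are compatible with the inclusion functor `C^istr ↪ C` [in the sense that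
an arrow of `C^istr` satisfies one of these properties with respect to `C^istr` if and only if it
does with respect to `C`]."

This file sets up `C^istr` as Mathlib's full subcategory `(isotropicObjects F).FullSubcategory`
with the restricted functor `istrFunctor F := ι ⋙ F`, and proves the COMPATIBILITY clause of
Prop. 1.9 (v): for an arrow of `C^istr`, being of Frobenius type / of a given Frobenius degree /
a pre-step / a pull-back morphism / a base-isomorphism / base-FSM / a base-identity or
`Div`-identity endomorphism / an isometry / co-angular / LB-invertible with respect to `C^istr`
is equivalent to the same property with respect to `C` (most are definitionally equal; co-angular
uses Def. 1.3 (vii)(b); pull-back morphisms use isotropic hulls, Def. 1.3 (vii)(a)). The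
Frobenioid structure of `C^istr` and the isotropification functor are in `Isotropification.lean`.
No statement of the paper is strengthened.
-/

namespace Literature.AlgebraicGeometry.Frobenioids

open CategoryTheory Opposite

universe w v v' u u'

namespace PreFrobenioid

variable {D : Type u} [Category.{v} D] {Φ : Dᵒᵖ ⥤ CommMonCat.{w}}
  {C : Type u'} [Category.{v'} C] (F : C ⥤ ElemFrobenioid Φ)

/-! ### `C^istr` and its pre-Frobenioid structure functor -/

/-- `C^istr ⊆ C`, the full subcategory of isotropic objects (FrdI Def. 1.2 (iv), Prop. 1.9 (v)).
[cite: MochizukiFrdI2008, Prop. 1.9(v) p.32] -/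
abbrev Istr : Type u' := (isotropicObjects F).FullSubcategory

/-- The restriction `C^istr → F_Φ` of `C → F_Φ` to `C^istr` (FrdI Prop. 1.9 (v): "`C^istr`
[equipped with the restriction to `C^istr` of the given functor `C → F_Φ`]").
[cite: MochizukiFrdI2008, Prop. 1.9(v) p.32] -/
abbrev istrFunctor : Istr F ⥤ ElemFrobenioid Φ := (isotropicObjects F).ι ⋙ F

variable {F}

/-- An isotropic object of `C` as an object of `C^istr`. [cite: MochizukiFrdI2008, Prop. 1.9(v) p.32] -/
abbrev Istr.mk (X : C) (hX : IsIsotropic F X) : Istr F := ⟨X, hX⟩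

/-! ### Definitional compatibilities -/

section rfl_lemmas

variable {X Y : Istr F} (f : X ⟶ Y)

/-- `Base` in `C^istr` is `Base` in `C`. [cite: MochizukiFrdI2008, Prop. 1.9(v) p.32] -/
theorem base_istr : Base (istrFunctor F) f = Base F f.hom := rfl
/-- `Div` in `C^istr` is `Div` in `C`. [cite: MochizukiFrdI2008, Prop. 1.9(v) p.32] -/
theorem div_istr : Div (istrFunctor F) f = Div F f.hom := rfl
/-- `deg_Fr` in `C^istr` is `deg_Fr` in `C` ("preserves … Frobenius degrees").
[cite: MochizukiFrdI2008, Prop. 1.9(v) p.32] -/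
theorem degFr_istr : degFr (istrFunctor F) f = degFr F f.hom := rfl
/-- Compatibility: linear. [cite: MochizukiFrdI2008, Prop. 1.9(v) p.32] -/
theorem isLinear_istr_iff : IsLinear (istrFunctor F) f ↔ IsLinear F f.hom := Iff.rfl
/-- Compatibility: isometries. [cite: MochizukiFrdI2008, Prop. 1.9(v) p.32] -/
theorem isIsometry_istr_iff : IsIsometry (istrFunctor F) f ↔ IsIsometry F f.hom := Iff.rfl
/-- Compatibility: base-isomorphisms. [cite: MochizukiFrdI2008, Prop. 1.9(v) p.32] -/
theorem isBaseIso_istr_iff : IsBaseIso (istrFunctor F) f ↔ IsBaseIso F f.hom := Iff.rfl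
/-- Compatibility: base-FSM-morphisms. [cite: MochizukiFrdI2008, Prop. 1.9(v) p.32] -/
theorem isBaseFSM_istr_iff : IsBaseFSM (istrFunctor F) f ↔ IsBaseFSM F f.hom := Iff.rfl
/-- Compatibility: pre-steps. [cite: MochizukiFrdI2008, Prop. 1.9(v) p.32] -/
theorem isPreStep_istr_iff : IsPreStep (istrFunctor F) f ↔ IsPreStep F f.hom := Iff.rfl

end rfl_lemmas

/-- Compatibility: base-identity endomorphisms. [cite: MochizukiFrdI2008, Prop. 1.9(v) p.32] -/
theorem isBaseIdentity_istr_iff {X : Istr F} (f : X ⟶ X) :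
    IsBaseIdentity (istrFunctor F) f ↔ IsBaseIdentity F f.hom := Iff.rfl

/-- Compatibility: `Div`-identity endomorphisms. [cite: MochizukiFrdI2008, Prop. 1.9(v) p.32] -/
theorem isDivIdentity_istr_iff {X : Istr F} (f : X ⟶ X) :
    IsDivIdentity (istrFunctor F) f ↔ IsDivIdentity F f.hom := Iff.rfl

/-- Isomorphisms of `C^istr` are the arrows whose underlying arrow is an isomorphism (full
subcategory). [cite: MochizukiFrdI2008, Prop. 1.9(v) p.32] -/
theorem isIso_istr_iff {X Y : Istr F} (f : X ⟶ Y) : IsIso f ↔ IsIso f.hom :=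
  (ObjectProperty.isIso_hom_iff f).symm

/-! ### Co-angular, LB-invertible, Frobenius type -/

/-- Compatibility: co-angular morphisms (a factorisation in `C` of an arrow out of an isotropic
object has isotropic intermediate objects, Def. 1.3 (vii)(b)).
[cite: MochizukiFrdI2008, Prop. 1.9(v) p.32] -/
theorem isCoAngular_istr_iff (hF : IsFrobenioid F) {X Y : Istr F} (f : X ⟶ Y) :
    IsCoAngular (istrFunctor F) f ↔ IsCoAngular F f.hom := by
  constructor
  · intro h X' Y' γ β α hfac hα hβ₁ hβ₂ hbi
    have hX' : IsIsotropic F X' := hF.vii_b γ X.property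
    have hY' : IsIsotropic F Y' := hF.vii_b (γ ≫ β) X.property
    have := h (X := Istr.mk X' hX') (Y := Istr.mk Y' hY') (ObjectProperty.homMk γ)
      (ObjectProperty.homMk β) (ObjectProperty.homMk α) (ObjectProperty.hom_ext _ hfac) hα hβ₁ hβ₂ hbi
    exact (isIso_istr_iff _).mp this
  · intro h X' Y' γ β α hfac hα hβ₁ hβ₂ hbi
    have := h γ.hom β.hom α.hom (congrArg InducedCategory.Hom.hom hfac) hα hβ₁ hβ₂ hbi
    exact (isIso_istr_iff _).mpr this

/-- Compatibility: LB-invertible morphisms. [cite: MochizukiFrdI2008, Prop. 1.9(v) p.32] -/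
theorem isLBInvertible_istr_iff (hF : IsFrobenioid F) {X Y : Istr F} (f : X ⟶ Y) :
    IsLBInvertible (istrFunctor F) f ↔ IsLBInvertible F f.hom :=
  and_congr (isCoAngular_istr_iff hF f) Iff.rfl

/-- Compatibility: morphisms of Frobenius type. [cite: MochizukiFrdI2008, Prop. 1.9(v) p.32] -/
theorem isFrobeniusType_istr_iff (hF : IsFrobenioid F) {X Y : Istr F} (f : X ⟶ Y) :
    IsFrobeniusType (istrFunctor F) f ↔ IsFrobeniusType F f.hom :=
  and_congr (isLBInvertible_istr_iff hF f) Iff.rfl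

/-- Compatibility: co-angular pre-steps. [cite: MochizukiFrdI2008, Prop. 1.9(v) p.32] -/
theorem isCoAngularPreStep_istr_iff (hF : IsFrobenioid F) {X Y : Istr F} (f : X ⟶ Y) :
    IsCoAngularPreStep (istrFunctor F) f ↔ IsCoAngularPreStep F f.hom :=
  and_congr (isCoAngular_istr_iff hF f) Iff.rfl

/-- `(ψ^*)⁻¹ Div ψ` computed in `C^istr` is the same element as in `C`.
[cite: MochizukiFrdI2008, Prop. 1.9(v) p.32] -/
theorem invDiv_istr {X Y : Istr F} (ψ : X ⟶ Y) (h : IsBaseIso (istrFunctor F) ψ) :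
    invDiv (istrFunctor F) ψ h = invDiv F ψ.hom h := rfl

/-! ### Pull-back morphisms -/

/-- Compatibility: pull-back morphisms, direction `C ⇒ C^istr` ("a fortiori", p. 33).
[cite: MochizukiFrdI2008, Prop. 1.9(v) p.33] -/
theorem isPullbackMorphism_istr_of {X Y : Istr F} (f : X ⟶ Y) (h : IsPullbackMorphism F f.hom) :
    IsPullbackMorphism (istrFunctor F) f := by
  intro Z
  constructor
  · intro g g' hgg'
    apply ObjectProperty.hom_ext
    apply (h Z.obj).1
    exact Subtype.ext (Prod.ext
      (congrArg InducedCategory.Hom.hom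
        (congrArg (fun p : PullbackHomData (istrFunctor F) f Z => p.1.1) hgg'))
      (congrArg (fun p : PullbackHomData (istrFunctor F) f Z => p.1.2) hgg'))
  · rintro ⟨⟨g, b⟩, hgb⟩
    obtain ⟨γ, hγ⟩ := (h Z.obj).2 ⟨(g.hom, b), hgb⟩
    refine ⟨ObjectProperty.homMk γ, Subtype.ext (Prod.ext ?_ ?_)⟩
    · exact ObjectProperty.hom_ext _ (congrArg (fun p : PullbackHomData F f.hom Z.obj => p.1.1) hγ)
    · exact congrArg (fun p : PullbackHomData F f.hom Z.obj => p.1.2) hγ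

/-- Compatibility: pull-back morphisms, direction `C^istr ⇒ C` (test an arbitrary object of `C`
through its isotropic hull, Def. 1.3 (vii)(a)). [cite: MochizukiFrdI2008, Prop. 1.9(v) p.33] -/
theorem isPullbackMorphism_of_istr (hF : IsFrobenioid F) {X Y : Istr F} (f : X ⟶ Y)
    (h : IsPullbackMorphism (istrFunctor F) f) : IsPullbackMorphism F f.hom := by
  have hC := hF.isPreFrobenioid.isTotallyEpimorphic
  intro Z
  obtain ⟨Z', k, hk⟩ := hF.vii_a Z
  haveI : IsIso (Base F k) := hk.2.1.2
  haveI := hC.epi k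
  let Z₁ : Istr F := Istr.mk Z' hk.2.2.1
  constructor
  · intro γ γ' hγγ'
    have h1 : γ ≫ f.hom = γ' ≫ f.hom := congrArg (fun p : PullbackHomData F f.hom Z => p.1.1) hγγ'
    have h2 : Base F γ = Base F γ' := congrArg (fun p : PullbackHomData F f.hom Z => p.1.2) hγγ'
    obtain ⟨δ, hδ, -⟩ := hk.2.2.2 γ X.property
    obtain ⟨δ', hδ', -⟩ := hk.2.2.2 γ' X.property
    have key : (ObjectProperty.homMk δ : Z₁ ⟶ X) = ObjectProperty.homMk δ' := by
      apply (h Z₁).1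
      apply Subtype.ext
      apply Prod.ext
      · apply ObjectProperty.hom_ext
        show δ ≫ f.hom = δ' ≫ f.hom
        rw [← cancel_epi k, ← Category.assoc, hδ, ← Category.assoc, hδ', h1]
      · show Base F δ = Base F δ'
        rw [← cancel_epi (Base F k), ← base_comp, hδ, ← base_comp, hδ', h2]
    rw [← hδ, ← hδ', show δ = δ' from congrArg InducedCategory.Hom.hom key]
  · rintro ⟨⟨g, b⟩, hgb⟩
    dsimp only at hgb
    obtain ⟨g', hg', -⟩ := hk.2.2.2 g Y.property
    let b' : baseObj F Z' ⟶ baseObj F X.obj := inv (Base F k) ≫ b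
    obtain ⟨γ', hγ'⟩ := (h Z₁).2 ⟨(ObjectProperty.homMk g', b'), by
      show Base F g' = (inv (Base F k) ≫ b) ≫ Base F f.hom
      rw [← cancel_epi (Base F k), ← base_comp, hg', hgb, Category.assoc, IsIso.hom_inv_id_assoc]⟩
    have h1 : γ'.hom ≫ f.hom = g' := congrArg InducedCategory.Hom.hom
      (congrArg (fun p : PullbackHomData (istrFunctor F) f Z₁ => p.1.1) hγ')
    have h2 : Base F γ'.hom = inv (Base F k) ≫ b :=
      congrArg (fun p : PullbackHomData (istrFunctor F) f Z₁ => p.1.2) hγ'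
    refine ⟨k ≫ γ'.hom, Subtype.ext (Prod.ext ?_ ?_)⟩
    · show (k ≫ γ'.hom) ≫ f.hom = g
      rw [Category.assoc, h1, hg']
    · show Base F (k ≫ γ'.hom) = b
      rw [base_comp, h2, IsIso.hom_inv_id_assoc]

/-- Compatibility: pull-back morphisms. [cite: MochizukiFrdI2008, Prop. 1.9(v) p.33] -/
theorem isPullbackMorphism_istr_iff (hF : IsFrobenioid F) {X Y : Istr F} (f : X ⟶ Y) :
    IsPullbackMorphism (istrFunctor F) f ↔ IsPullbackMorphism F f.hom :=
  ⟨isPullbackMorphism_of_istr hF f, isPullbackMorphism_istr_of f⟩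

/-! ### Objects of `C^istr` are isotropic in `C^istr`; identities are isotropic hulls -/

/-- Every object of `C^istr` is isotropic with respect to `C^istr`.
[cite: MochizukiFrdI2008, Prop. 1.9(v) p.32] -/
theorem isIsotropic_istr (A : Istr F) : IsIsotropic (istrFunctor F) A :=
  fun _ ψ hψ₁ hψ₂ => (isIso_istr_iff ψ).mpr (A.property ψ.hom hψ₁ hψ₂)

/-- `C^istr` is of isotropic type. [cite: MochizukiFrdI2008, Prop. 1.9(v) p.32] -/
theorem isOfIsotropicType_istr : IsOfIsotropicType (istrFunctor F) := fun A => isIsotropic_istr A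

/-- In `C^istr` the identity of every object is an isotropic hull.
[cite: MochizukiFrdI2008, Prop. 1.9(v) p.32] -/
theorem isIsotropicHull_istr_id (A : Istr F) : IsIsotropicHull (istrFunctor F) (𝟙 A) :=
  ⟨div_id _ A, isPreStep_of_isIso _ (𝟙 A), isIsotropic_istr A,
    fun _ γ _ => ⟨γ, Category.id_comp γ, fun β hβ => by rw [← hβ, Category.id_comp]⟩⟩

end PreFrobenioid

end Literature.AlgebraicGeometry.Frobenioids
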